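import Summits.ResolutionOfSingularities.ResolutionOfSingularities.Theses.IndSmooth
import Summits.ResolutionOfSingularities.ResolutionOfSingularities.Theorems.CleanCoversCoverResolutionCalibration
import Literature.AlgebraicGeometry.Resolution.NormalizationOfVarietiesProofs
import HarnessLib

/-!
# Crux `CleanCovers.CoverResolution` (stmt-ResolutionOfSingularities-15104), line `strategy-split`
# v2.2: certificate — local resolvability of NORMAL varieties over perfect fields already gives
# `IndSmooth.LurelPerfect`

Route `ResolutionOfSingularities/CleanCovers`, line lead continuation seat c2 (2026-08-17).

`relLUPerfect_of_locallyResolvablePerfect` (`CleanCoversCoverResolutionCalibration.lean`) derives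
relative local uniformization over perfect fields (verbatim the route item `IndSmooth.LurelPerfect`,
stmt-ResolutionOfSingularities-16086) from pointwise Zariski-local resolvability of ALL integral
separated finite-type schemes over perfect fields of characteristic `p`. This file shows that the
same hypothesis restricted to NORMAL schemes (all stalks integrally closed) suffices:
`lurelPerfect_of_locallyResolvableNormalPerfect`. Proof (Zariski–Samuel VI §17 + E. Noether):
enlarge the prescribed finitely generated `R ⊆ O` by an affine model of `O` (`exists_affineModel`),
NORMALISE — the integral closure of the finitely generated model `R ⊔ A₀` in `K` is finite over it
(E. Noether, `NoetherFiniteIntegralClosure_holds`), hence finitely generated over `k`, still inside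
the integrally closed valuation ring `O`, with fraction field `K` and integrally closed stalks
(localisations of an integrally closed domain) — and uniformize by the centre of `O` on a local
resolution of the normal affine model (`exists_affineModel_regular_of_locallyResolvable`).

No named fact is taken as a hypothesis; no `sorry`.
-/

set_option linter.dupNamespace false -- mandated namespace of this single-conjunct summit

noncomputable section

namespace Summit.ResolutionOfSingularities.ResolutionOfSingularities.Theorems

open CategoryTheory AlgebraicGeometry TopologicalSpace
open Literature.AlgebraicGeometry.Resolution

/-- **Normalisation of an affine model inside a valuation ring.** A finitely generated
`k`-subalgebra `R ⊆ O` of a field `K` with `Frac R = K` is contained in a finitely generated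
`k`-subalgebra `N ⊆ O` with `Frac N = K` all of whose local rings (stalks of `Spec N`) are
integrally closed: `N` is the integral closure of `R` in `K`, finite over `R` by E. Noether's
theorem (`NoetherFiniteIntegralClosure_holds`), inside `O` because valuation rings are integrally
closed. [cite: ZariskiSamuel1960, Ch. VI §17 (affine models and centres)] -/
private theorem exists_normal_affineModel_le_valuationSubring {k K : Type} [Field k] [Field K]
    [Algebra k K] (O : ValuationSubring K) (R : Subalgebra k K)
    (hRO : R.toSubring ≤ O.toSubring) (hRfg : R.FG) (hRfr : IsFractionRing R K) :
    ∃ N : Subalgebra k K, R ≤ N ∧ N.toSubring ≤ O.toSubring ∧ N.FG ∧ IsFractionRing N K ∧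
      ∀ x : Spec (.of N), IsIntegrallyClosed ((Spec (.of N)).presheaf.stalk x) := by
  classical
  haveI : Algebra.FiniteType k R := R.fg_iff_finiteType.mp hRfg
  haveI := hRfr
  -- the integral closure `A'` of `R` in `K`, finite over `R` (E. Noether)
  let A' : Subalgebra R K := integralClosure R K
  haveI : Module.Finite R A' := NoetherFiniteIntegralClosure_holds.self k R K
  haveI hft : Algebra.FiniteType k A' :=
    Algebra.FiniteType.trans (inferInstance : Algebra.FiniteType k R) (Module.Finite.finiteType A')
  haveI : IsFractionRing A' K := integralClosure.isFractionRing_of_finite_extension K K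
  haveI hic : IsIntegrallyClosed A' :=
    (isIntegrallyClosed_iff_isIntegrallyClosedIn K).mpr inferInstance
  -- the same ring as a `k`-subalgebra of `K`
  let N : Subalgebra k K := A'.restrictScalars k
  have hRN : R ≤ N := fun x hx =>
    isIntegral_algebraMap (R := R) (A := K) (x := (⟨x, hx⟩ : R))
  have hNO : N.toSubring ≤ O.toSubring := by
    intro x hx
    have hx' : IsIntegral R x := hx
    letI : Algebra R O := (Subring.inclusion hRO).toAlgebra
    haveI : IsScalarTower R O K := IsScalarTower.of_algebraMap_eq (fun _ => rfl)
    obtain ⟨y, hy⟩ := (isIntegrallyClosed_iff K).mp inferInstance (hx'.tower_top (A := O))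
    rw [← hy]
    exact y.2
  haveI hftN : Algebra.FiniteType k N := hft
  haveI hicN : IsIntegrallyClosed N := hic
  refine ⟨N, hRN, hNO, N.fg_iff_finiteType.mpr hftN, isFractionRing_of_le hRN hRfr, fun x => ?_⟩
  letI : Algebra N ((Spec (.of N)).presheaf.stalk x) := StructureSheaf.stalkAlgebra N x
  haveI : IsLocalization.AtPrime ((Spec (.of N)).presheaf.stalk x) x.asIdeal :=
    StructureSheaf.IsLocalization.to_stalk N x
  exact isIntegrallyClosed_of_isLocalization ((Spec (.of N)).presheaf.stalk x)
    x.asIdeal.primeCompl (Ideal.primeCompl_le_nonZeroDivisors _)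

/-- **LocRes_perfect for NORMAL schemes ⇒ relative local uniformization over perfect fields
(`IndSmooth.LurelPerfect`).** If every point of every NORMAL (all stalks integrally closed)
integral separated finite-type scheme over every perfect field of characteristic `p` has a
resolvable open neighbourhood, then for every perfect field `k` of characteristic `p`, every
finitely generated `K/k`, every valuation ring `O ∋ k` of `K` and every finitely generated
`k`-subalgebra `R ⊆ O`, some finitely generated `A` with `R ⊆ A ⊆ O`, `Frac A = K`, is regular at
the centre of `O`. Proof: enlarge `R` by an affine model of `O` (`exists_affineModel`), normalise
(`exists_normal_affineModel_le_valuationSubring`: E. Noether's finiteness of integral closure and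
integral closedness of valuation rings), and uniformize by the centre of `O` on a local resolution
of the normal model (`exists_affineModel_regular_of_locallyResolvable`). So the local half of the
line may assume normality. [cite: ZariskiSamuel1960, Ch. VI §17 (affine models and centres)] -/
theorem lurelPerfect_of_locallyResolvableNormalPerfect : (∀ p : ℕ, p.Prime → ∀ (k : Type) [Field k] [CharP k p] [PerfectField k] (X : AlgebraicGeometry.Scheme.{0}) (g : X ⟶ AlgebraicGeometry.Spec (.of k)), AlgebraicGeometry.IsSeparated g → AlgebraicGeometry.LocallyOfFiniteType g → AlgebraicGeometry.QuasiCompact g → AlgebraicGeometry.IsIntegral X → (∀ x : X, IsIntegrallyClosed (X.presheaf.stalk x)) → ∀ x : X, ∃ U : X.Opens, x ∈ U ∧ Literature.AlgebraicGeometry.Resolution.Scheme.HasResolution (U : AlgebraicGeometry.Scheme.{0})) → Summit.ResolutionOfSingularities.ResolutionOfSingularities.Theses.IndSmooth.LurelPerfect := by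
  intro hLoc p hp k K _ _ _ _ _ hKfg O hO R hRfg hRO
  classical
  have hloc := hLoc p hp k
  -- an affine model of `O` above `R`
  obtain ⟨A₀, hA₀O, hA₀fg, hA₀fr⟩ := exists_affineModel k K hKfg O hO
  have hR'O : (R ⊔ A₀).toSubring ≤ O.toSubring := by
    let Oalg : Subalgebra k K := { O.toSubring with algebraMap_mem' := hO }
    change R ⊔ A₀ ≤ Oalg
    exact sup_le (fun x hx => hRO hx) (fun x hx => hA₀O hx)
  have hR'fr : IsFractionRing ↥(R ⊔ A₀) K := isFractionRing_of_le le_sup_right hA₀fr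
  have hR'fg : (R ⊔ A₀).FG := hRfg.sup hA₀fg
  -- its normalisation `N`, a normal affine model of `O` above `R`
  obtain ⟨N, hR'N, hNO, hNfg, hNfr, hNnormal⟩ :=
    exists_normal_affineModel_le_valuationSubring O (R ⊔ A₀) hR'O hR'fg hR'fr
  -- `Spec N` is a normal integral affine finite-type `k`-scheme, hence locally resolvable
  have hlocN : ∀ x : Spec (.of N), ∃ W : (Spec (.of N)).Opens, x ∈ W ∧
      Scheme.HasResolution (W : Scheme.{0}) := by
    haveI : Algebra.FiniteType k N := N.fg_iff_finiteType.mp hNfg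
    let f : Spec (.of N) ⟶ Spec (.of k) := Spec.map (CommRingCat.ofHom (algebraMap k N))
    haveI : LocallyOfFiniteType f :=
      (HasRingHomProperty.Spec_iff (P := @LocallyOfFiniteType)).mpr
        (RingHom.finiteType_algebraMap.mpr ‹_›)
    haveI : IsDomain (CommRingCat.of N) := inferInstanceAs (IsDomain N)
    exact hloc (Spec (.of N)) f inferInstance inferInstance inferInstance inferInstance hNnormal
  obtain ⟨A, hA, hle, hAfg, hreg⟩ :=
    exists_affineModel_regular_of_locallyResolvable O N hNO hNfg hNfr hlocN
  exact ⟨A, hA, (le_sup_left.trans hR'N).trans hle, hAfg, isFractionRing_of_le hle hNfr, hreg⟩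

end Summit.ResolutionOfSingularities.ResolutionOfSingularities.Theorems

end
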